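import Summits.NavierStokesRegularity.NavierStokesRegularity.Theorems.OddMorawetzLocal.Negative.OddMorawetzLocalRefutationData5
import Summits.NavierStokesRegularity.NavierStokesRegularity.Theorems.OddMorawetzLocal.Negative.OddMorawetzLocalRefutationData3
import Summits.NavierStokesRegularity.NavierStokesRegularity.Theorems.OddMorawetzLocal.Negative.OddMorawetzLocalRefutationDefsFast
import Summits.NavierStokesRegularity.NavierStokesRegularity.Theorems.OddMorawetzLocal.Negative.OddMorawetzLocalEvaluatorDefs
import HarnessLib

/-!
# Crux `OddMorawetzLocal` (stmt-NavierStokesRegularity-1376) — kernel values of the live densities (part 3)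

The exact evaluation, by the kernel (`decide +kernel`) on the evaluator vocabulary `OddMorawetzLocalEvaluatorDefs`, of the
Morawetz pairing `Q_p(v)/(π√π)` of the live weight-3 density `R` (17 terms) at the explicit divergence-free odd polynomial-Gaussian
fields u₁ = (−2x₁, 2x₀, 0)e^{-|x|²}, u₂ = (−2x₀²x₁, −2x₀+2x₀³, 0)e^{-|x|²}: each theorem states `evalRes 1000 (chunk) field = (true, value)` for a chunk of ≤ 18 terms of the density
(the flag certifies divergence-freeness of the field, success and evenness of the Hermite expansions and evenness of the
local product; the pairing is additive in the terms, so `Q_p(v) = (Σ chunk values)·π√π` by the soundness theorem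
`morawetzPairing_pgv_eq`). Totals: u1: -1/20; u2: 2686217/246005760.
No analysis; lands `--supports` the crux item; consumed by the weight-3 assembly of the refutation.
-/

set_option linter.dupNamespace false

namespace Summit.NavierStokesRegularity.NavierStokesRegularity.Theorems.OddMorawetz

/-- `Q/(π√π)` contribution of the terms `0 … 17` of R at u1: `-1/20` (flag `true`). -/
theorem val3_R_u1_0 : evalRes 1000 (((isoPolyF (isoDesc3.getD 0 (.poly []))).drop 0).take 18) (![[(-2, 0, 1, 0)], [(2, 1, 0, 0)], []] : EField) =
    (true, (-1/20 : ℚ)) := by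
  decide +kernel

/-- `Q/(π√π)` contribution of the terms `0 … 17` of R at u2: `2686217/246005760` (flag `true`). -/
theorem val3_R_u2_0 : evalRes 1000 (((isoPolyF (isoDesc3.getD 0 (.poly []))).drop 0).take 18) (![[(-2, 2, 1, 0)], [(-2, 1, 0, 0), (2, 3, 0, 0)], []] : EField) =
    (true, (2686217/246005760 : ℚ)) := by
  decide +kernel

end Summit.NavierStokesRegularity.NavierStokesRegularity.Theorems.OddMorawetz
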